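import Summits.CriticalPhenomena.PercolationContinuityZ3.Theorems.FK.InfiniteVolumeDLRKernelInsert
import Literature.Probability.Percolation.DeletionTolerance
import Literature.Probability.Percolation.PercolationProofs
import Literature.Probability.LatticeModels.SiteBurtonKeane
import HarnessLib

/-!
# FK-continuity transplant, FO-10 (infinite-volume structure): the finite-volume random-cluster measure
# `φ^ξ_{Δ,p,q}` has the one-edge conditional probabilities (4.38) at every inside lattice edge — Grimmett 2006, (3.3)/(4.12)

Registered R90 (cell INBOX l.6412, 2026-08-24); registry row FO-10b-g409; label DLL-B (coordinator fk-4 g195).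
Cell `fk-continuity` (bschramm), FO-10b lineage; support file for the FK-continuity transplant
(`--supports stmt-CriticalPhenomena-4575`); builds on p205010 (kernel theorem, internal audit signed; external
expert review pending). CONDITIONAL cell (FH AND TP_FK open at the same `p` for `q > 1`; K1); the transplant is a
typed reduction, not a proof of FK continuity — this file is UNCONDITIONAL finite-volume structure for general `d`,
`0 ≤ p ≤ 1`, `q > 0`; no defs, no named facts, no sorries, standard axioms; NOT a binder discharge, NOT `_r4`;
`_r3` « 2 / 0 ☑ » unchanged, n_open = 2.

## What this file proves

The measure-level form of the kernel's one-edge ratio `rcCondProb_insert_mul_one_sub`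
(`InfiniteVolumeDLRKernelInsert.lean`, Grimmett's (3.3) for the weights (4.12)): the finite-volume random-cluster
measure with boundary condition `ξ`, `φ^ξ_{Δ,p,q}` — the tree's `rcCondLaw p q Δ ξ` (`InfiniteVolumeDLRDefs.lean`),
a probability measure on `Ω = {0,1}^{pairs of ℤ^d}` carried by the configurations `η ∪ (ξ ∖ E_Δ)`, `η ⊆ E_Δ` — has,
at every INSIDE lattice edge `e = ⟨x,y⟩ ∈ E_Δ`, the ONE-EDGE CONDITIONAL PROBABILITIES (4.38) in exactly the shape
consumed by `isDLRRandomCluster_of_oneEdge` (`InfiniteVolumeDLROneEdgeIff.lean`) and by the local-limit theorem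
`isDLRRandomCluster_of_localLimit` (`InfiniteVolumeDLRLocalLimit.lean`):

* `rcCondLaw_real_eq_sum_mul_indicator` — `φ^ξ_Δ(S) = ∑_{η ⊆ E_Δ} φ^ξ_Δ(η) · 1_S(η ∪ (ξ ∖ E_Δ))` for measurable `S`;
* `rcCondLaw_real_edgeOpen_inter_preimage_eq` — for `e = ⟨x,y⟩ ∈ E_Δ` and every measurable `H₀`,
  `φ^ξ_Δ({e open} ∩ {ω ∖ e ∈ H₀}) = p · φ^ξ_Δ({ω ∖ e ∈ H₀ ∩ K_e}) + p/(p + q(1-p)) · φ^ξ_Δ({ω ∖ e ∈ H₀ ∖ K_e})`,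
  `K_e = {x ↔ y}` (pairing `η ∌ e` with `η ∪ e`, whose images under `ω ↦ ω ∖ e` coincide, and the kernel ratio).
* `isProbabilityMeasure_rcCondLaw`, `rcCondLaw_ae_subset_edgeSet` — `φ^ξ_{Δ,p,q}` is a probability measure, carried by
  lattice configurations when `ξ ⊆ 𝔼^d` (the hypotheses `[IsFiniteMeasure (μ n)]` / `hlat` of the local-limit theorem).

These are the hypotheses `hE` of `isDLRRandomCluster_of_localLimit` for the approximants `μ_n = φ^{ξ_n}_{Λ_n,p,q}`:
Grimmett's Theorem (4.31) for the weak limits `W_{p,q}` proper (`InfiniteVolumeDLRLocalLimit.lean`).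

## References

* G. Grimmett, *The Random-Cluster Model*, Springer 2006: Thm. (3.1) eq. (3.3) p. 38; §4.2 (4.11)–(4.13) p. 71;
  Prop. (4.37) eq. (4.38) p. 82. [Grimmett2006]
-/

noncomputable section

open MeasureTheory Set Filter
open scoped Topology ENNReal

namespace Summit.CriticalPhenomena.PercolationContinuityZ3.Theorems.FK

open Literature.Probability.Percolation Literature.Probability.LatticeModels

variable {d : ℕ} {p q : ℝ}

/-- **The law `φ^ξ_{Λ,p,q}` of a measurable event, as a finite sum**: `φ^ξ_Λ(S) = ∑_{η ⊆ E_Λ} φ^ξ_Λ(η) · 1_S(η ∪ (ξ ∖ E_Λ))`.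
[cite: Grimmett2006, §4.2 (4.11)–(4.12)] -/
theorem rcCondLaw_real_eq_sum_mul_indicator (hp : p ∈ Set.Icc (0 : ℝ) 1) (hq : 0 < q) (Λ : Finset (Site d))
    (ξ : BondConfig (Site d)) {S : Set (BondConfig (Site d))} (hS : MeasurableSet S) :
    (rcCondLaw p q Λ ξ).real S = ∑ η ∈ (edgesIn (zdGraph d) Λ).powerset,
      rcCondProb p q Λ ξ η * S.indicator (fun _ => (1 : ℝ)) ((↑η : Set (Sym2 (Site d))) ∪ (ξ \ ↑(edgesIn (zdGraph d) Λ))) := by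
  classical
  rw [measureReal_def, rcCondLaw_eq, Measure.finsetSum_apply]
  simp only [Measure.smul_apply, smul_eq_mul, Measure.dirac_apply' _ hS]
  rw [ENNReal.toReal_sum]
  · refine Finset.sum_congr rfl fun η _ => ?_
    rw [ENNReal.toReal_mul, ENNReal.toReal_ofReal (rcCondProb_nonneg hp hq Λ ξ η)]
    by_cases h : ((↑η : Set (Sym2 (Site d))) ∪ (ξ \ ↑(edgesIn (zdGraph d) Λ))) ∈ S
    · rw [Set.indicator_of_mem h, Set.indicator_of_mem h, Pi.one_apply, ENNReal.toReal_one]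
    · rw [Set.indicator_of_notMem h, Set.indicator_of_notMem h, ENNReal.toReal_zero]
  · intro η _
    exact ENNReal.mul_ne_top ENNReal.ofReal_ne_top
      (ne_top_of_le_ne_top ENNReal.one_ne_top (Set.indicator_le_self' (fun _ _ => zero_le_one) _))

open scoped Classical in
/-- **The finite-volume random-cluster measure `φ^ξ_{Δ,p,q}` has the one-edge conditional probabilities (4.38)
at every inside lattice edge** (Grimmett 2006, Thm. (3.1) eq. (3.3) for the kernel (4.12)): for `e = ⟨x,y⟩ ∈ E_Δ`,
`0 ≤ p ≤ 1`, `q > 0` and every measurable `H₀`,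
`φ^ξ_Δ({e open} ∩ {ω ∖ e ∈ H₀}) = p · φ^ξ_Δ({ω ∖ e ∈ H₀ ∩ K_e}) + p/(p + q(1-p)) · φ^ξ_Δ({ω ∖ e ∈ H₀ ∖ K_e})`,
`K_e = {x ↔ y}` — the hypothesis shape of `isDLRRandomCluster_of_oneEdge`. [cite: Grimmett2006, Thm. (3.1) eq. (3.3), §4.2 (4.12)–(4.13), Prop. (4.37) eq. (4.38)] -/
theorem rcCondLaw_real_edgeOpen_inter_preimage_eq (hp : p ∈ Set.Icc (0 : ℝ) 1) (hq : 0 < q)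
    (Δ : Finset (Site d)) (ξ : BondConfig (Site d)) {x y : Site d} (he : s(x, y) ∈ edgesIn (zdGraph d) Δ)
    {H₀ : Set (BondConfig (Site d))} (hH₀ : MeasurableSet H₀) :
    (rcCondLaw p q Δ ξ).real ({ω | s(x, y) ∈ ω} ∩ (fun η => η \ {s(x, y)}) ⁻¹' H₀) =
      p * (rcCondLaw p q Δ ξ).real ((fun η => η \ {s(x, y)}) ⁻¹' (H₀ ∩ openConn x y)) +
        p / (p + q * (1 - p)) * (rcCondLaw p q Δ ξ).real ((fun η => η \ {s(x, y)}) ⁻¹' (H₀ ∩ (openConn x y)ᶜ)) := by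
  classical
  set e : Sym2 (Site d) := s(x, y) with he_def
  set U := edgesIn (zdGraph d) Δ with hU
  set f : BondConfig (Site d) → BondConfig (Site d) := fun η => η \ {e} with hf
  have hfm : Measurable f := measurable_closeEdges _
  have hJm : MeasurableSet {ω : BondConfig (Site d) | e ∈ ω} := measurableSet_mem e
  have hKm : MeasurableSet (openConn x y : Set (BondConfig (Site d))) := measurableSet_openConn_holds x y
  rw [rcCondLaw_real_eq_sum_mul_indicator hp hq Δ ξ (hJm.inter (hH₀.preimage hfm)),
    rcCondLaw_real_eq_sum_mul_indicator hp hq Δ ξ ((hH₀.inter hKm).preimage hfm),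
    rcCondLaw_real_eq_sum_mul_indicator hp hq Δ ξ ((hH₀.inter hKm.compl).preimage hfm),
    Finset.mul_sum, Finset.mul_sum]
  -- split every sum along `η ↦ (η ∌ e, η ∋ e)`
  have heU : e ∉ U.erase e := Finset.notMem_erase e U
  have hsplit : ∀ g : Finset (Sym2 (Site d)) → ℝ,
      ∑ η ∈ U.powerset, g η = ∑ η ∈ (U.erase e).powerset, (g η + g (insert e η)) := by
    intro g
    conv_lhs => rw [← Finset.insert_erase he]
    rw [Finset.sum_powerset_insert heU, Finset.sum_add_distrib]
  simp only [← hU]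
  rw [hsplit, hsplit, hsplit, ← Finset.sum_add_distrib]
  refine Finset.sum_congr rfl fun η hη => ?_
  have hηU : η ⊆ U.erase e := Finset.mem_powerset.1 hη
  have heη : e ∉ η := fun h => heU (hηU h)
  -- the point charged by `η`, and by `insert e η`
  set ζ : BondConfig (Site d) := (↑η : Set (Sym2 (Site d))) ∪ (ξ \ ↑U) with hζ
  have heζ : e ∉ ζ := by
    rintro (h | h)
    · exact heη (Finset.mem_coe.1 h)
    · exact h.2 (Finset.mem_coe.2 he)
  have hins : ((↑(insert e η) : Set (Sym2 (Site d))) ∪ (ξ \ ↑U)) = insert e ζ := by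
    rw [Finset.coe_insert, Set.insert_union]
  have hfζ : f ζ = ζ := by simp only [hf, sdiff_singleton_eq_self heζ]  -- `ζ \ {e} = ζ`
  have hfins : f (insert e ζ) = ζ := by
    simp only [hf, Set.insert_sdiff_of_mem _ (Set.mem_singleton e), sdiff_singleton_eq_self heζ]
  simp only [Set.indicator, Set.mem_inter_iff, Set.mem_setOf_eq, Set.mem_preimage, hins, hfζ, hfins,
    Set.mem_insert_iff, true_or, heζ, false_and, if_false, mul_zero, zero_add, true_and, Set.mem_compl_iff]
  -- the kernel's one-edge ratio
  have hratio := rcCondProb_insert_mul_one_sub hp hq Δ ξ he heη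
  rw [← hζ] at hratio
  by_cases hH : ζ ∈ H₀
  · by_cases hK : ζ ∈ openConn x y
    · have hR : (openGraph ζ).Reachable x y := hK
      simp only [hH, hK, not_true_eq_false, and_true, and_false, if_true, if_false, mul_one, mul_zero, add_zero]
      rw [if_pos hR] at hratio
      linear_combination hratio
    · have hR : ¬ (openGraph ζ).Reachable x y := hK
      simp only [hH, hK, not_false_eq_true, and_true, and_false, if_true, if_false, mul_one, mul_zero, zero_add]
      rw [if_neg hR] at hratio
      linear_combination hratio
  · simp only [hH, false_and, if_false, mul_zero, add_zero]


/-! ### `φ^ξ_{Λ,p,q}` is a probability measure carried by lattice configurations -/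

/-- **`φ^ξ_{Λ,p,q}` is a probability measure** (`0 ≤ p ≤ 1`, `q > 0`). [cite: Grimmett2006, §4.2 (4.11)–(4.12)] -/
theorem isProbabilityMeasure_rcCondLaw (hp : p ∈ Set.Icc (0 : ℝ) 1) (hq : 0 < q) (Λ : Finset (Site d))
    (ξ : BondConfig (Site d)) : IsProbabilityMeasure (rcCondLaw p q Λ ξ) := by
  classical
  constructor
  rw [rcCondLaw_eq, Measure.finsetSum_apply]
  simp only [Measure.smul_apply, smul_eq_mul, measure_univ, mul_one]
  rw [← ENNReal.ofReal_sum_of_nonneg (fun η _ => rcCondProb_nonneg hp hq Λ ξ η), sum_rcCondProb_eq_one hp hq Λ ξ,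
    ENNReal.ofReal_one]

/-- **`φ^ξ_{Λ,p,q}` with a LATTICE boundary condition `ξ ⊆ 𝔼^d` is carried by lattice configurations** (it charges
the configurations `η ∪ (ξ ∖ E_Λ)`, `η ⊆ E_Λ ⊆ 𝔼^d`) — the hypothesis `hlat` of `isDLRRandomCluster_of_localLimit`.
[cite: Grimmett2006, §4.2 (4.11)–(4.12)] -/
theorem rcCondLaw_ae_subset_edgeSet (hp : p ∈ Set.Icc (0 : ℝ) 1) (hq : 0 < q) (Λ : Finset (Site d))
    {ξ : BondConfig (Site d)} (hξ : ξ ⊆ (zdGraph d).edgeSet) :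
    ∀ᵐ ω ∂(rcCondLaw p q Λ ξ), ω ⊆ (zdGraph d).edgeSet := by
  classical
  haveI := isProbabilityMeasure_rcCondLaw hp hq Λ ξ
  have hm : MeasurableSet {ω : BondConfig (Site d) | ¬ ω ⊆ (zdGraph d).edgeSet} :=
    (measurableSet_setOf_subset_right _).compl
  have h0 : (rcCondLaw p q Λ ξ).real {ω : BondConfig (Site d) | ¬ ω ⊆ (zdGraph d).edgeSet} = 0 := by
    rw [rcCondLaw_real_eq_sum_mul_indicator hp hq Λ ξ hm]
    refine Finset.sum_eq_zero fun η hη => ?_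
    rw [Set.indicator_of_notMem, mul_zero]
    simp only [Set.mem_setOf_eq, not_not]
    exact Set.union_subset (fun e he => (mem_edgesIn_iff.1 (Finset.mem_powerset.1 hη (Finset.mem_coe.1 he))).1)
      (Set.sdiff_subset.trans hξ)
  rw [ae_iff]
  exact (measureReal_eq_zero_iff (measure_ne_top _ _)).1 h0

end Summit.CriticalPhenomena.PercolationContinuityZ3.Theorems.FK

end
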